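import Literature.AnabelianGeometry.AbsoluteAnabelian.AbsTopIProp410CoFreeBridge
import Literature.AnabelianGeometry.AbsoluteAnabelian.AbsTopIProp410DenseProofs
import HarnessLib

/-!
# [AbsTopI] Prop 4.10 (i)/(iii) AT THE CONSTRUCTION: density, uniqueness, and the meaning of
# `SelfCompletionAt` (proof-only)

S. Mochizuki, *Topics in Absolute Anabelian Geometry I: Generalities* [AbsTopI] (J. Math. Sci.
Univ. Tokyo 19 (2012)), §0 p. 8, Prop 4.10 (i)/(iii) p. 60, Def 4.11 (i)(c) pp. 62–63 (manuscript
pagination, lit key `paper:url-11ac98ba15fc`, read on the page).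

abc-iut-L4-t13 gen 3's `AbsTopIProp410CoFreeBridge.lean` (p417235) instantiates the sub-DAG kits of
`AbsTopIProp410Sub.lean` (abc-iut-w5-d025, p414417) at the REAL `(Q, Δ)`-co-free completion
(`AbsTopI/CoFreeCompletion*.lean`) and names the node statements there: `Prop410iiiAt E`,
`SelfCompletionAt Z`.  The kit-level consequences of `AbsTopIProp410DenseProofs.lean` (gen 4,
p417808) specialise, because at the construction the kit's `η` IS dense
(`CoFreeQKit.denseRange_η_ofConstruction` ← `denseRange_toCoFreeCompletion`, the printed "natural
dense homomorphism" of §0 p. 8):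

* `Prop410iiiAt.denseRange_f` — (iii) at the construction ⟹ the tempered `f : Π^tp_X → Π^tp_Y` is
  DENSE (Def 4.11 (i)(c)'s printed adjective), unconditionally in the kit;
* `Prop410iiiAt.existsUnique` — the reconstructing isomorphism `(Π^tp_X)^{Π̂_Y/co-fr} ≃ₜ* Π^tp_Y`
  is UNIQUE;
* `Prop410iiiAt.surjective_f_iff` — under (iii), surjectivity of `f` ⟺ surjectivity of the §0 map
  `Π^tp_X → (Π^tp_X)^{Π̂_Y/co-fr}` (audit input on row iii.L03; print asserts neither);
* `selfCompletionAt_iff_isHomeomorph` — `SelfCompletionAt Z` ⟺ the §0 map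
  `Π^tp_Z → (Π^tp_Z)^{Π̂_Z/co-fr}` is a HOMEOMORPHISM (hence an isomorphism of topological groups):
  the exact content of Prop 4.10 (i)'s last clause at the construction — an input about temperedness
  (abc-iut-L3's `TemperedCurve` interface; abc-iut-w5-d011 2026-08-26T01:50:25Z (ii)), not
  derivable from the bare interface, and `SelfCompletionAt.unique`.

HONEST FRAMING: refereed prerequisite paper; the nodes stay named `Prop`s; nothing here bears on
[IUTchIII] Cor 3.12; typed ≠ proved.
-/

noncomputable section

open Topology

namespace Literature.AnabelianGeometry.AbsoluteAnabelian.AbsTopI.Prop410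

open Literature.AnabelianGeometry.SemiGraphs
open Literature.AnabelianGeometry.AbsoluteAnabelian.AbsTopI

variable {p : ℕ} [Fact p.Prime]

/-! ### Prop 4.10 (iii) at the construction -/

namespace Prop410iiiAt

variable {X Y : TemperedCurve p} {E : DeCuspidalization X Y}

/-- (iii) at the construction is (iii) for the kit `CoFreeQKit.ofConstruction`.
[cite: MochizukiAbsTopI2012, Prop 4.10 (iii) p.60] -/
theorem prop410iii (h : Prop410iiiAt E) :
    Prop410iii E (CoFreeQKit.ofConstruction X Y.PiHat E.fHat) := h

/-- **(iii) at the construction ⟹ `f` is dense** — [AbsTopI] Def 4.11 (i)(c) pp. 62–63 "a dense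
homomorphism `φ : Π_j → Π_{j+1}` which is isomorphic to the co-free completion of `Π_j`": the
adjective follows from the isomorphism and §0's density (`denseRange_toCoFreeCompletion`).
[cite: MochizukiAbsTopI2012, Def 4.11 (i)(c) p.62] -/
theorem denseRange_f (h : Prop410iiiAt E) : DenseRange E.f :=
  Prop410iii.denseRange_f h (CoFreeQKit.denseRange_η_ofConstruction X Y.PiHat E.fHat)

/-- Under (iii) at the construction: `f` surjective ⟺ the §0 map
`Π^tp_X → (Π^tp_X)^{Π̂_Y/co-fr}` is surjective (print: "dense"; neither surjectivity is printed).
[cite: MochizukiAbsTopI2012, §0 p.8] -/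
theorem surjective_f_iff (h : Prop410iiiAt E) :
    Function.Surjective E.f ↔
      Function.Surjective (toCoFreeCompletion (E.fHat.comp X.toHat) X.DeltaTemp) :=
  Prop410iii.surjective_f_iff h

/-- Under (iii) at the construction: `Ker f = Ker(Π^tp_X → (Π^tp_X)^{Π̂_Y/co-fr})`.
[cite: MochizukiAbsTopI2012, Prop 4.10 (iii) p.60] -/
theorem ker_eq (h : Prop410iiiAt E) :
    E.f.toMonoidHom.ker = (toCoFreeCompletion (E.fHat.comp X.toHat) X.DeltaTemp).toMonoidHom.ker :=
  Prop410iii.ker_eq h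

/-- **Uniqueness of the reconstruction at the construction**: under (iii) there is EXACTLY ONE
isomorphism `(Π^tp_X)^{Π̂_Y/co-fr} ≃ₜ* Π^tp_Y` carrying the natural map to `f`.
[cite: MochizukiAbsTopI2012, Prop 4.10 (iii) p.60] -/
theorem existsUnique (h : Prop410iiiAt E) :
    ∃! e : CoFreeCompletion (E.fHat.comp X.toHat) X.DeltaTemp ≃ₜ* Y.PiTemp,
      ∀ g : X.PiTemp, e (toCoFreeCompletion (E.fHat.comp X.toHat) X.DeltaTemp g) = E.f g :=
  Prop410iii.existsUnique h (CoFreeQKit.denseRange_η_ofConstruction X Y.PiHat E.fHat)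

end Prop410iiiAt

/-- (iii) for `Δ^tp` at the construction implies (iii) at the construction.
[cite: MochizukiAbsTopI2012, Prop 4.10 (iii) p.60] -/
theorem Prop410iiiDeltaAt.prop410iiiAt {X Y : TemperedCurve p} {E : DeCuspidalization X Y}
    (h : Prop410iiiDeltaAt E) : Prop410iiiAt E :=
  Prop410iiiDelta.prop410iii h

/-! ### Prop 4.10 (i), last clause, at the construction -/

/-- **`SelfCompletionAt Z` ⟺ the §0 map `Π^tp_Z → (Π^tp_Z)^{Π̂_Z/co-fr}` is a homeomorphism**
(then an isomorphism of topological groups): [AbsTopI] Prop 4.10 (i) p. 60 "`π₁^tp(X)` [...] is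
naturally isomorphic to its `π₁(X)`-co-free completion" at the construction of §0.
[cite: MochizukiAbsTopI2012, Prop 4.10 (i) p.60] -/
theorem selfCompletionAt_iff_isHomeomorph (Z : TemperedCurve p) :
    SelfCompletionAt Z ↔
      IsHomeomorph (toCoFreeCompletion ((ContinuousMonoidHom.id Z.PiHat).comp Z.toHat) Z.DeltaTemp) :=
  selfCompletion_iff_isHomeomorph

/-- Under `SelfCompletionAt Z` the identifying isomorphism is unique.
[cite: MochizukiAbsTopI2012, Prop 4.10 (i) p.60] -/
theorem SelfCompletionAt.existsUnique {Z : TemperedCurve p} (h : SelfCompletionAt Z) :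
    ∃! e : CoFreeCompletion ((ContinuousMonoidHom.id Z.PiHat).comp Z.toHat) Z.DeltaTemp ≃ₜ* Z.PiTemp,
      ∀ g : Z.PiTemp, e (toCoFreeCompletion ((ContinuousMonoidHom.id Z.PiHat).comp Z.toHat)
        Z.DeltaTemp g) = g := by
  obtain ⟨e, he⟩ := h
  exact ⟨e, he, fun e' he' => SelfCompletion.unique
    (CoFreeQKit.denseRange_η_ofConstruction Z Z.PiHat (ContinuousMonoidHom.id Z.PiHat)) e' e he' he⟩

/-- Under `SelfCompletionAt Z`, the §0 map `Π^tp_Z → (Π^tp_Z)^{Π̂_Z/co-fr}` is injective — the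
co-free-completion half of [AbsTopI] Prop 4.10 (i)'s "is injective" at the construction.
[cite: MochizukiAbsTopI2012, Prop 4.10 (i) p.60] -/
theorem SelfCompletionAt.injective_toCoFreeCompletion {Z : TemperedCurve p} (h : SelfCompletionAt Z) :
    Function.Injective
      (toCoFreeCompletion ((ContinuousMonoidHom.id Z.PiHat).comp Z.toHat) Z.DeltaTemp) :=
  ((selfCompletionAt_iff_isHomeomorph Z).mp h).injective

end Literature.AnabelianGeometry.AbsoluteAnabelian.AbsTopI.Prop410
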